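import Summits.CriticalPhenomena.PercolationContinuityZ3.Theorems.PercNearOneGluingNoHeavyLowerTailSahiGridPatternDiagCert
import Summits.CriticalPhenomena.PercolationContinuityZ3.Theorems.PercNearOneGluingNoHeavyLowerTailSahiGridPatternKleitman
import Summits.CriticalPhenomena.PercolationContinuityZ3.Theorems.PercNearOneGluingNoHeavyLowerTailSahiGridPatternTwoChart

/-!
# `NoHeavyLowerTail` (crux stmt-CriticalPhenomena-4575), Sahi programme P1: **THE PAIR CERTIFICATE OF A UNION OF TWO INDEPENDENT
# CYLINDERS** — an explicit diagonal certificate for `U = X ∪ Y` (`X` measurable in the free block, `Y` in the cell block);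
# its condition (T) holds in every dimension, so condition (N) alone makes `U × [3]^m` a good slot in every dimension

Support file (Sahi cell, seat `prim-sahi-p1`, generation 20; `--supports stmt-CriticalPhenomena-4575`).  Pure proofs, NO definitions,
no `sorry`, standard axioms.  Vocabulary of `…SahiGridPattern{CellForm,DiagCert}` (`glue`, `cylSet`, `fibre`, `sect`, `nuCount`, `lamU`,
`thetaVal`, `sStarD`).

THE MATHEMATICS.  Work on `[3]^{n+k} = [3]^n × [3]^k` (`glue ξ q`).  Let `X ⊆ [3]^{n+k}` depend only on the free block (`glue ξ q ∈ X ↔ ξ ∈ X_I`)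
and `Y` only on the cell block (`glue ξ q ∈ Y ↔ q ∈ Y_J`), with `X_I ⊆ [3]^n`, `Y_J ⊆ [3]^k` up-sets; `U = X ∪ Y`, `Z = X ∩ Y`, `K = n+k`,
`ν_A(x) = #{p ∈ A : p δ̸ x}`.  The PAIR CERTIFICATE ("X pays") is the vector
  `d(x) = 2^{K+1} − ν_U(x)` on `Z`,   `2^K − ν_{Y∖X}(x) = 2^K + ν_X(x) − ν_U(x)` on `X∖Y`,   `2^K` on `Y∖X`,   `0` off `U`,
written below as `d(x) = 2^K(1_X+1_Y) − 1_X(ν_U − ν_X) − 1_X 1_Y ν_X`.  THIS FILE PROVES, for every `n, k` and ALL such `X_I, Y_J`: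
* `d ≥ 0` (`pairCert_nonneg`) and **condition (T) of `…DiagCert`** (`pairCert_T`): `Σ_{x∈W} d(x) ≤ Σ_{x∈W} λ_U(x)` for every up-set `W`.
  The slack is EXACTLY `2^k Σ_{q∉Y_J} H_n(X_I, W^q) + Σ_{ξ∉X_I} (2^n − ν_{X_I}(ξ))·H_k(Y_J, W_ξ)` — two families of fibrewise coefficientwise
  Harris slacks (`H_n(X_I,V) = 2^n·#(X_I∩V) − N(X_I;V) ≥ 0`, `sum_ind_totDist_le`), over the cell-fibres `W^q` with `q ∉ Y_J` and the
  free-sections `W_ξ` with `ξ ∉ X_I`.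
* hence (`sStarD_cylSet_pairCert_nonneg_of_N`): **if the pair certificate satisfies condition (N)** `Θ_U(A×A′) ≤ Σ_{A∩A′} d` for all
  up-sets `A, A′ ⊆ [3]^{n+k}`, then `U × [3]^m` is a good slot of the pattern functional in EVERY dimension (`sStarD_cylSet_nonneg_of_diagCert`).
STATUS OF (N) (not asserted here): for `X_I, Y_J` PRINCIPAL (so `U = ↑a ∪ ↑b`, two orthants with disjoint supports) condition (N) for this `d`
was verified by exact computation for all such `U` with `n + k ≤ 3` (seat, exhaustive over all up-set pairs) and `n + k = 4` (kit jobs, exhaustive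
over all 17 792 748 up-sets `A` with the exact best `A′`), and found without violation in random sampling at `n + k = 5`; it FAILS for some
non-principal `X_I` already at `n + k = 3`.  In `G`-form, (N) for principal blocks reads
  `G(X∩Y;B,C) ≤ G(X;B,C) + G(Y;B,C)·0 + Σ_{ξ∈X_I} (2^n − ν_{X_I}(ξ))·H_k(Y_J,(B∩C)_ξ) + [Conjecture-P slack of Y]`
(memo FROM-prim-sahi-p1-gen20).  Nothing in this file asserts (N), `PatternPos d` for `d ≥ 4`, or Kahn's conjecture. [this work]
-/

namespace Summit.CriticalPhenomena.PercolationContinuityZ3.Theorems.SahiGridPattern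

open Finset SahiGrid3
open scoped BigOperators

variable {n k : ℕ}

/-! ### Small tools: `ν` as an indicator sum, `ν ≤ 2^d`, `ν` of unions and of block-measurable sets -/

/-- `ν_A(x) = Σ_p 1_A(p)·[p δ̸ x]`. [this work] -/
theorem nuCount_eq_sum_ind {d : ℕ} (A : Finset (Pd d)) (x : Pd d) :
    (nuCount A x : ℤ) = ∑ p : Pd d, ind A p * (if TotDist p x = true then (1:ℤ) else 0) := by
  unfold nuCount
  rw [Finset.card_filter, Nat.cast_sum]
  rw [← Finset.sum_subset (Finset.subset_univ A) (fun p _ hp => by unfold ind; rw [if_neg hp]; ring)]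
  refine Finset.sum_congr rfl fun p hp => ?_
  unfold ind; rw [if_pos hp]; push_cast; ring

/-- `ν_A(x) ≤ 2^d` (there are `2^d` points totally distinct from `x`). [this work] -/
theorem nuCount_le_two_pow {d : ℕ} (A : Finset (Pd d)) (x : Pd d) : (nuCount A x : ℤ) ≤ 2 ^ d := by
  rw [nuCount_eq_sum_ind, ← sum_ite_totDist_eq_pow x]
  refine Finset.sum_le_sum fun p _ => ?_
  have h1 := ind_le_one' A p
  by_cases h : TotDist p x = true
  · rw [if_pos h, mul_one]; exact h1
  · rw [if_neg h, mul_zero]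

/-- `ν_A(x) ≥ 0` as an integer. [this work] -/
theorem nuCount_cast_nonneg {d : ℕ} (A : Finset (Pd d)) (x : Pd d) : (0:ℤ) ≤ (nuCount A x : ℤ) := by exact_mod_cast Nat.zero_le _

/-- Indicator of a union: `1_{X∪Y} = 1_X + 1_Y − 1_X·1_Y`. [this work] -/
theorem ind_union_eq {γ : Type*} [DecidableEq γ] (X Y : Finset γ) (x : γ) : ind (X ∪ Y) x = ind X x + ind Y x - ind X x * ind Y x := by
  unfold ind
  by_cases hx : x ∈ X <;> by_cases hy : x ∈ Y <;> simp [hx, hy]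

/-- `ν_{X∪Y} = ν_X + ν_Y − ν_{X∩Y}` pointwise. [this work] -/
theorem nuCount_union_eq {d : ℕ} (X Y : Finset (Pd d)) (x : Pd d) :
    (nuCount (X ∪ Y) x : ℤ) = nuCount X x + nuCount Y x - nuCount (X ∩ Y) x := by
  rw [nuCount_eq_sum_ind, nuCount_eq_sum_ind, nuCount_eq_sum_ind, nuCount_eq_sum_ind, ← Finset.sum_add_distrib, ← Finset.sum_sub_distrib]
  refine Finset.sum_congr rfl fun p _ => ?_
  rw [ind_union_eq, ind_inter_eq_mul]; ring

/-- Indicator of a free-block-measurable set. [this work] -/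
theorem ind_glue_of_free {X : Finset (Pd (n + k))} {XI : Finset (Pd n)} (hX : ∀ ξ q, glue ξ q ∈ X ↔ ξ ∈ XI) (ξ : Pd n) (q : Pd k) :
    ind X (glue ξ q) = ind XI ξ := by
  unfold ind
  by_cases h : ξ ∈ XI
  · rw [if_pos ((hX ξ q).2 h), if_pos h]
  · rw [if_neg (fun h' => h ((hX ξ q).1 h')), if_neg h]

/-- Indicator of a cell-block-measurable set. [this work] -/
theorem ind_glue_of_cell {Y : Finset (Pd (n + k))} {YJ : Finset (Pd k)} (hY : ∀ ξ q, glue ξ q ∈ Y ↔ q ∈ YJ) (ξ : Pd n) (q : Pd k) :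
    ind Y (glue ξ q) = ind YJ q := by
  unfold ind
  by_cases h : q ∈ YJ
  · rw [if_pos ((hY ξ q).2 h), if_pos h]
  · rw [if_neg (fun h' => h ((hY ξ q).1 h')), if_neg h]

/-- `[glue η r δ̸ glue ξ q] = [η δ̸ ξ]·[r δ̸ q]`. [this work] -/
theorem ite_totDist_glue (η ξ : Pd n) (r q : Pd k) :
    (if TotDist (glue η r) (glue ξ q) = true then (1:ℤ) else 0) =
      (if TotDist η ξ = true then (1:ℤ) else 0) * (if TotDist r q = true then (1:ℤ) else 0) := by
  by_cases h : TotDist (glue η r) (glue ξ q) = true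
  · rw [if_pos h]; rw [totDist_glue] at h; rw [if_pos h.1, if_pos h.2]; ring
  · rw [if_neg h]; rw [totDist_glue, not_and_or] at h
    rcases h with h | h
    · rw [if_neg h]; ring
    · rw [if_neg h]; ring

/-- `ν` of a free-block-measurable set: `ν_X(glue ξ q) = 2^k · ν_{X_I}(ξ)`. [this work] -/
theorem nuCount_glue_of_free {X : Finset (Pd (n + k))} {XI : Finset (Pd n)} (hX : ∀ ξ q, glue ξ q ∈ X ↔ ξ ∈ XI) (ξ : Pd n) (q : Pd k) :
    (nuCount X (glue ξ q) : ℤ) = 2 ^ k * (nuCount XI ξ : ℤ) := by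
  rw [nuCount_eq_sum_ind, nuCount_eq_sum_ind, sum_glue]
  simp_rw [ind_glue_of_free hX, ite_totDist_glue]
  have h : ∀ η : Pd n, (∑ r : Pd k, ind XI η * ((if TotDist η ξ = true then (1:ℤ) else 0) * (if TotDist r q = true then (1:ℤ) else 0)))
      = 2 ^ k * (ind XI η * (if TotDist η ξ = true then (1:ℤ) else 0)) := fun η => by
    rw [show (∑ r : Pd k, ind XI η * ((if TotDist η ξ = true then (1:ℤ) else 0) * (if TotDist r q = true then (1:ℤ) else 0)))
        = (ind XI η * (if TotDist η ξ = true then (1:ℤ) else 0)) * ∑ r : Pd k, (if TotDist r q = true then (1:ℤ) else 0) by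
          rw [Finset.mul_sum]; exact Finset.sum_congr rfl fun r _ => by ring,
      sum_ite_totDist_eq_pow q]; ring
  rw [Finset.sum_congr rfl fun η _ => h η, ← Finset.mul_sum]

/-- `ν` of a cell-block-measurable set: `ν_Y(glue ξ q) = 2^n · ν_{Y_J}(q)`. [this work] -/
theorem nuCount_glue_of_cell {Y : Finset (Pd (n + k))} {YJ : Finset (Pd k)} (hY : ∀ ξ q, glue ξ q ∈ Y ↔ q ∈ YJ) (ξ : Pd n) (q : Pd k) :
    (nuCount Y (glue ξ q) : ℤ) = 2 ^ n * (nuCount YJ q : ℤ) := by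
  rw [nuCount_eq_sum_ind, nuCount_eq_sum_ind, sum_glue]
  simp_rw [ind_glue_of_cell hY, ite_totDist_glue]
  rw [Finset.sum_comm]
  have h : ∀ r : Pd k, (∑ η : Pd n, ind YJ r * ((if TotDist η ξ = true then (1:ℤ) else 0) * (if TotDist r q = true then (1:ℤ) else 0)))
      = 2 ^ n * (ind YJ r * (if TotDist r q = true then (1:ℤ) else 0)) := fun r => by
    rw [show (∑ η : Pd n, ind YJ r * ((if TotDist η ξ = true then (1:ℤ) else 0) * (if TotDist r q = true then (1:ℤ) else 0)))
        = (ind YJ r * (if TotDist r q = true then (1:ℤ) else 0)) * ∑ η : Pd n, (if TotDist η ξ = true then (1:ℤ) else 0) by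
          rw [Finset.mul_sum]; exact Finset.sum_congr rfl fun η _ => by ring,
      sum_ite_totDist_eq_pow ξ]; ring
  rw [Finset.sum_congr rfl fun r _ => h r, ← Finset.mul_sum]

/-- `ν` of the intersection of a free-measurable and a cell-measurable set: `ν_{X∩Y}(glue ξ q) = ν_{X_I}(ξ)·ν_{Y_J}(q)`. [this work] -/
theorem nuCount_glue_of_inter {X Y : Finset (Pd (n + k))} {XI : Finset (Pd n)} {YJ : Finset (Pd k)}
    (hX : ∀ ξ q, glue ξ q ∈ X ↔ ξ ∈ XI) (hY : ∀ ξ q, glue ξ q ∈ Y ↔ q ∈ YJ) (ξ : Pd n) (q : Pd k) :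
    (nuCount (X ∩ Y) (glue ξ q) : ℤ) = (nuCount XI ξ : ℤ) * (nuCount YJ q : ℤ) := by
  rw [nuCount_eq_sum_ind, nuCount_eq_sum_ind, nuCount_eq_sum_ind, sum_glue, Finset.sum_mul_sum]
  refine Finset.sum_congr rfl fun η _ => Finset.sum_congr rfl fun r _ => ?_
  rw [ind_inter_eq_mul, ind_glue_of_free hX, ind_glue_of_cell hY, ite_totDist_glue]; ring

/-! ### Fibrewise Harris in indicator form -/

/-- **Coefficientwise Harris, pointwise-slack form**: for up-sets `A, V ⊆ [3]^d`, `Σ_{v} 1_V(v)·(2^d·1_A(v) − ν_A(v)) ≥ 0`. [this work] -/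
theorem sum_ind_mul_harrisSlack_nonneg {d : ℕ} (A V : Finset (Pd d)) (hA : IsUpperSet (A : Set (Pd d))) (hV : IsUpperSet (V : Set (Pd d))) :
    0 ≤ ∑ v : Pd d, ind V v * (2 ^ d * ind A v - (nuCount A v : ℤ)) := by
  have h := sum_ind_totDist_le d A V hA hV
  have e : (∑ v : Pd d, ind V v * (2 ^ d * ind A v - (nuCount A v : ℤ))) =
      2 ^ d * (∑ p, ind A p * ind V p) - ∑ p, ∑ q, ind A p * ind V q * (if TotDist p q = true then (1:ℤ) else 0) := by
    simp_rw [nuCount_eq_sum_ind]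
    rw [Finset.mul_sum]
    have e2 : (∑ p : Pd d, ∑ q : Pd d, ind A p * ind V q * (if TotDist p q = true then (1:ℤ) else 0)) =
        ∑ v : Pd d, ind V v * ∑ p : Pd d, ind A p * (if TotDist p v = true then (1:ℤ) else 0) := by
      rw [Finset.sum_comm]
      refine Finset.sum_congr rfl fun v _ => ?_
      rw [Finset.mul_sum]
      exact Finset.sum_congr rfl fun p _ => by ring
    rw [e2, ← Finset.sum_sub_distrib]
    exact Finset.sum_congr rfl fun v _ => by ring
  rw [e]; linarith

/-! ### The pair certificate: nonnegativity and condition (T) -/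

/-- **The pair certificate is nonnegative.** [this work] -/
theorem pairCert_nonneg (X Y : Finset (Pd (n + k))) (x : Pd (n + k)) :
    0 ≤ (2:ℤ) ^ (n + k) * (ind X x + ind Y x) - ind X x * ((nuCount (X ∪ Y) x : ℤ) - nuCount X x) - ind X x * ind Y x * (nuCount X x : ℤ) := by
  have hU := nuCount_le_two_pow (X ∪ Y) x
  have hU0 := nuCount_cast_nonneg (X ∪ Y) x
  have hX0 := nuCount_cast_nonneg X x
  have hXle := nuCount_le_two_pow X x
  unfold ind
  by_cases hx : x ∈ X <;> by_cases hy : x ∈ Y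
  · rw [if_pos hx, if_pos hy]; nlinarith
  · rw [if_pos hx, if_neg hy]; nlinarith
  · rw [if_neg hx, if_pos hy]; nlinarith
  · rw [if_neg hx, if_neg hy]; simp

/-- **CONDITION (T) FOR THE PAIR CERTIFICATE, every `n, k`**: if `X` is free-block-measurable with up-set trace `X_I ⊆ [3]^n` and `Y` is
cell-block-measurable with up-set trace `Y_J ⊆ [3]^k`, then for every up-set `W ⊆ [3]^{n+k}`:
`Σ_{x∈W} d(x) ≤ Σ_{x∈W} λ_{X∪Y}(x)`, `d` the pair certificate.  The slack is `2^k Σ_{q∉Y_J} H_n(X_I,W^q) + Σ_{ξ∉X_I}(2^n−ν_{X_I}(ξ))·H_k(Y_J,W_ξ)`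
(fibrewise coefficientwise Harris). [this work] -/
theorem pairCert_T {X Y : Finset (Pd (n + k))} {XI : Finset (Pd n)} {YJ : Finset (Pd k)}
    (hX : ∀ ξ q, glue ξ q ∈ X ↔ ξ ∈ XI) (hY : ∀ ξ q, glue ξ q ∈ Y ↔ q ∈ YJ)
    (hXI : IsUpperSet (XI : Set (Pd n))) (hYJ : IsUpperSet (YJ : Set (Pd k)))
    (W : Finset (Pd (n + k))) (hW : IsUpperSet (W : Set (Pd (n + k)))) :
    (∑ x ∈ W, ((2:ℤ) ^ (n + k) * (ind X x + ind Y x) - ind X x * ((nuCount (X ∪ Y) x : ℤ) - nuCount X x) - ind X x * ind Y x * (nuCount X x : ℤ)))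
      ≤ ∑ x ∈ W, lamU (X ∪ Y) x := by
  rw [← sub_nonneg, ← Finset.sum_sub_distrib, sum_mem_eq_sum_ind_mul, sum_glue]
  -- pointwise block form of the slack `λ_U − d` at `glue ξ q`
  have hpt : ∀ (ξ : Pd n) (q : Pd k), ind W (glue ξ q) * (lamU (X ∪ Y) (glue ξ q) - ((2:ℤ) ^ (n + k) * (ind X (glue ξ q) + ind Y (glue ξ q))
      - ind X (glue ξ q) * ((nuCount (X ∪ Y) (glue ξ q) : ℤ) - nuCount X (glue ξ q)) - ind X (glue ξ q) * ind Y (glue ξ q) * (nuCount X (glue ξ q) : ℤ)))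
      = ind W (glue ξ q) * (ind XI ξ * (1 - ind YJ q) * (2 ^ (n + k) - 2 ^ k * (nuCount XI ξ : ℤ))
        + (1 - ind XI ξ) * (2 ^ (n + k) * ind YJ q - 2 ^ k * (nuCount XI ξ : ℤ) - 2 ^ n * (nuCount YJ q : ℤ)
          + (nuCount XI ξ : ℤ) * (nuCount YJ q : ℤ))) := by
    intro ξ q
    unfold lamU
    rw [ind_union_eq, nuCount_union_eq, ind_glue_of_free hX, ind_glue_of_cell hY, nuCount_glue_of_free hX, nuCount_glue_of_cell hY,
      nuCount_glue_of_inter hX hY]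
    ring
  simp_rw [hpt]
  -- the two fibrewise Harris families
  have HA : ∀ q : Pd k, 0 ≤ ∑ ξ : Pd n, ind (fibre W q) ξ * (2 ^ n * ind XI ξ - (nuCount XI ξ : ℤ)) :=
    fun q => sum_ind_mul_harrisSlack_nonneg XI (fibre W q) hXI (isUpperSet_fibre hW q)
  have HB : ∀ ξ : Pd n, 0 ≤ ∑ q : Pd k, ind (sect W ξ) q * (2 ^ k * ind YJ q - (nuCount YJ q : ℤ)) :=
    fun ξ => sum_ind_mul_harrisSlack_nonneg YJ (sect W ξ) hYJ (isUpperSet_sect hW ξ)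
  -- the identity: total = 2^k Σ_q (1 − 1_{YJ} q)·(A_q) + Σ_ξ (1 − 1_{XI} ξ)(2^n − ν_{XI} ξ)·(B_ξ)
  have key : (∑ ξ : Pd n, ∑ q : Pd k, ind W (glue ξ q) * (ind XI ξ * (1 - ind YJ q) * (2 ^ (n + k) - 2 ^ k * (nuCount XI ξ : ℤ))
        + (1 - ind XI ξ) * (2 ^ (n + k) * ind YJ q - 2 ^ k * (nuCount XI ξ : ℤ) - 2 ^ n * (nuCount YJ q : ℤ)
          + (nuCount XI ξ : ℤ) * (nuCount YJ q : ℤ))))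
      = 2 ^ k * (∑ q : Pd k, (1 - ind YJ q) * ∑ ξ : Pd n, ind (fibre W q) ξ * (2 ^ n * ind XI ξ - (nuCount XI ξ : ℤ)))
        + ∑ ξ : Pd n, (1 - ind XI ξ) * (2 ^ n - (nuCount XI ξ : ℤ)) * ∑ q : Pd k, ind (sect W ξ) q * (2 ^ k * ind YJ q - (nuCount YJ q : ℤ)) := by
    rw [Finset.mul_sum]
    have e1 : (∑ q : Pd k, 2 ^ k * ((1 - ind YJ q) * ∑ ξ : Pd n, ind (fibre W q) ξ * (2 ^ n * ind XI ξ - (nuCount XI ξ : ℤ))))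
        = ∑ ξ : Pd n, ∑ q : Pd k, 2 ^ k * (1 - ind YJ q) * (ind W (glue ξ q) * (2 ^ n * ind XI ξ - (nuCount XI ξ : ℤ))) := by
      rw [Finset.sum_comm]
      refine Finset.sum_congr rfl fun q _ => ?_
      rw [Finset.mul_sum, Finset.mul_sum]
      refine Finset.sum_congr rfl fun ξ _ => ?_
      rw [ind_fibre]; ring
    have e2 : (∑ ξ : Pd n, (1 - ind XI ξ) * (2 ^ n - (nuCount XI ξ : ℤ)) * ∑ q : Pd k, ind (sect W ξ) q * (2 ^ k * ind YJ q - (nuCount YJ q : ℤ)))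
        = ∑ ξ : Pd n, ∑ q : Pd k, (1 - ind XI ξ) * (2 ^ n - (nuCount XI ξ : ℤ)) * (ind W (glue ξ q) * (2 ^ k * ind YJ q - (nuCount YJ q : ℤ))) := by
      refine Finset.sum_congr rfl fun ξ _ => ?_
      rw [Finset.mul_sum]
      refine Finset.sum_congr rfl fun q _ => ?_
      rw [ind_sect]
    rw [e1, e2, ← Finset.sum_add_distrib]
    refine Finset.sum_congr rfl fun ξ _ => ?_
    rw [← Finset.sum_add_distrib]
    refine Finset.sum_congr rfl fun q _ => ?_
    rw [pow_add]
    ring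
  rw [key]
  have hA : 0 ≤ 2 ^ k * (∑ q : Pd k, (1 - ind YJ q) * ∑ ξ : Pd n, ind (fibre W q) ξ * (2 ^ n * ind XI ξ - (nuCount XI ξ : ℤ))) :=
    mul_nonneg (pow_nonneg (by norm_num) k) (Finset.sum_nonneg fun q _ =>
      mul_nonneg (by linarith [ind_le_one' YJ q]) (HA q))
  have hB : 0 ≤ ∑ ξ : Pd n, (1 - ind XI ξ) * (2 ^ n - (nuCount XI ξ : ℤ)) * ∑ q : Pd k, ind (sect W ξ) q * (2 ^ k * ind YJ q - (nuCount YJ q : ℤ)) :=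
    Finset.sum_nonneg fun ξ _ => mul_nonneg (mul_nonneg (by linarith [ind_le_one' XI ξ]) (by linarith [nuCount_le_two_pow XI ξ])) (HB ξ)
  linarith

/-! ### Every-dimension goodness from condition (N) alone -/

/-- **A UNION OF TWO INDEPENDENT CYLINDERS IS GOOD IN EVERY DIMENSION, GIVEN CONDITION (N) FOR ITS PAIR CERTIFICATE**: with `X, Y` as in
`pairCert_T` (`U = X ∪ Y ⊆ [3]^{n+k}`), if `Θ_U(A×A′) ≤ Σ_{A∩A′} d` for all up-sets `A, A′ ⊆ [3]^{n+k}` (condition (N) of `…DiagCert` for the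
pair certificate `d`), then `0 ≤ sStarD (U × [3]^m) B C` for every `m` and all up-sets `B, C ⊆ [3]^{m+(n+k)}`.  ((T) is `pairCert_T`;
`d ≥ 0` is `pairCert_nonneg`; the conclusion is `sStarD_cylSet_nonneg_of_diagCert`.)  For principal `X_I, Y_J` (N) is the open inequality
(★₁) of the generation-20 memo, verified by exact computation for `n + k ≤ 4`. [this work] -/
theorem sStarD_cylSet_pairCert_nonneg_of_N {m : ℕ} {X Y : Finset (Pd (n + k))} {XI : Finset (Pd n)} {YJ : Finset (Pd k)}
    (hX : ∀ ξ q, glue ξ q ∈ X ↔ ξ ∈ XI) (hY : ∀ ξ q, glue ξ q ∈ Y ↔ q ∈ YJ)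
    (hXI : IsUpperSet (XI : Set (Pd n))) (hYJ : IsUpperSet (YJ : Set (Pd k)))
    (hN : ∀ A A' : Finset (Pd (n + k)), IsUpperSet (A : Set (Pd (n + k))) → IsUpperSet (A' : Set (Pd (n + k))) →
      (∑ q ∈ A, ∑ r ∈ A', thetaVal (X ∪ Y) q r) ≤
        ∑ x ∈ A ∩ A', ((2:ℤ) ^ (n + k) * (ind X x + ind Y x) - ind X x * ((nuCount (X ∪ Y) x : ℤ) - nuCount X x)
          - ind X x * ind Y x * (nuCount X x : ℤ)))
    {B C : Finset (Pd (m + (n + k)))} (hB : IsUpperSet (B : Set (Pd (m + (n + k))))) (hC : IsUpperSet (C : Set (Pd (m + (n + k))))) :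
    0 ≤ sStarD (cylSet (X ∪ Y) : Finset (Pd (m + (n + k)))) B C :=
  sStarD_cylSet_nonneg_of_diagCert (X ∪ Y)
    (fun x => (2:ℤ) ^ (n + k) * (ind X x + ind Y x) - ind X x * ((nuCount (X ∪ Y) x : ℤ) - nuCount X x) - ind X x * ind Y x * (nuCount X x : ℤ))
    (fun x => pairCert_nonneg X Y x) (fun W hW => pairCert_T hX hY hXI hYJ W hW) hN hB hC

/-! ### Appendix (same generation): the (T)-slack in closed form, and condition (N) as a lower bound on `sStarD` itself -/

/-- **The (T)-slack of the pair certificate in closed form** (every `n, k`, any finset `W`): `Σ_{x∈W} (λ_{X∪Y}(x) − d(x))` equals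
`2^k Σ_q (1 − 1_{Y_J}(q))·[Σ_ξ 1_{W^q}(ξ)(2^n 1_{X_I}(ξ) − ν_{X_I}(ξ))] + Σ_ξ (1 − 1_{X_I}(ξ))(2^n − ν_{X_I}(ξ))·[Σ_q 1_{W_ξ}(q)(2^k 1_{Y_J}(q) − ν_{Y_J}(q))]`
(fibre `W^q = fibre W q`, section `W_ξ = sect W ξ`).  For an up-set `W` both brackets are fibrewise coefficientwise-Harris slacks (`pairCert_T`). [this work] -/
theorem pairCert_slack_eq {X Y : Finset (Pd (n + k))} {XI : Finset (Pd n)} {YJ : Finset (Pd k)}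
    (hX : ∀ ξ q, glue ξ q ∈ X ↔ ξ ∈ XI) (hY : ∀ ξ q, glue ξ q ∈ Y ↔ q ∈ YJ) (W : Finset (Pd (n + k))) :
    (∑ x ∈ W, (lamU (X ∪ Y) x - ((2:ℤ) ^ (n + k) * (ind X x + ind Y x) - ind X x * ((nuCount (X ∪ Y) x : ℤ) - nuCount X x)
        - ind X x * ind Y x * (nuCount X x : ℤ))))
      = 2 ^ k * (∑ q : Pd k, (1 - ind YJ q) * ∑ ξ : Pd n, ind (fibre W q) ξ * (2 ^ n * ind XI ξ - (nuCount XI ξ : ℤ)))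
        + ∑ ξ : Pd n, (1 - ind XI ξ) * (2 ^ n - (nuCount XI ξ : ℤ)) * ∑ q : Pd k, ind (sect W ξ) q * (2 ^ k * ind YJ q - (nuCount YJ q : ℤ)) := by
  rw [sum_mem_eq_sum_ind_mul, sum_glue]
  have hpt : ∀ (ξ : Pd n) (q : Pd k), ind W (glue ξ q) * (lamU (X ∪ Y) (glue ξ q) - ((2:ℤ) ^ (n + k) * (ind X (glue ξ q) + ind Y (glue ξ q))
      - ind X (glue ξ q) * ((nuCount (X ∪ Y) (glue ξ q) : ℤ) - nuCount X (glue ξ q)) - ind X (glue ξ q) * ind Y (glue ξ q) * (nuCount X (glue ξ q) : ℤ)))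
      = ind W (glue ξ q) * (ind XI ξ * (1 - ind YJ q) * (2 ^ (n + k) - 2 ^ k * (nuCount XI ξ : ℤ))
        + (1 - ind XI ξ) * (2 ^ (n + k) * ind YJ q - 2 ^ k * (nuCount XI ξ : ℤ) - 2 ^ n * (nuCount YJ q : ℤ)
          + (nuCount XI ξ : ℤ) * (nuCount YJ q : ℤ))) := by
    intro ξ q
    unfold lamU
    rw [ind_union_eq, nuCount_union_eq, ind_glue_of_free hX, ind_glue_of_cell hY, nuCount_glue_of_free hX, nuCount_glue_of_cell hY,
      nuCount_glue_of_inter hX hY]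
    ring
  simp_rw [hpt]
  rw [Finset.mul_sum]
  have e1 : (∑ q : Pd k, 2 ^ k * ((1 - ind YJ q) * ∑ ξ : Pd n, ind (fibre W q) ξ * (2 ^ n * ind XI ξ - (nuCount XI ξ : ℤ))))
      = ∑ ξ : Pd n, ∑ q : Pd k, 2 ^ k * (1 - ind YJ q) * (ind W (glue ξ q) * (2 ^ n * ind XI ξ - (nuCount XI ξ : ℤ))) := by
    rw [Finset.sum_comm]
    refine Finset.sum_congr rfl fun q _ => ?_
    rw [Finset.mul_sum, Finset.mul_sum]
    refine Finset.sum_congr rfl fun ξ _ => ?_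
    rw [ind_fibre]; ring
  have e2 : (∑ ξ : Pd n, (1 - ind XI ξ) * (2 ^ n - (nuCount XI ξ : ℤ)) * ∑ q : Pd k, ind (sect W ξ) q * (2 ^ k * ind YJ q - (nuCount YJ q : ℤ)))
      = ∑ ξ : Pd n, ∑ q : Pd k, (1 - ind XI ξ) * (2 ^ n - (nuCount XI ξ : ℤ)) * (ind W (glue ξ q) * (2 ^ k * ind YJ q - (nuCount YJ q : ℤ))) := by
    refine Finset.sum_congr rfl fun ξ _ => ?_
    rw [Finset.mul_sum]
    refine Finset.sum_congr rfl fun q _ => ?_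
    rw [ind_sect]
  rw [e1, e2, ← Finset.sum_add_distrib]
  refine Finset.sum_congr rfl fun ξ _ => ?_
  rw [← Finset.sum_add_distrib]
  refine Finset.sum_congr rfl fun q _ => ?_
  rw [pow_add]
  ring

/-- **Condition (N) for the pair certificate as a LOWER BOUND ON THE PATTERN FUNCTIONAL** (every `n, k`): (N) for `d` is implied by (indeed
equivalent to) `Φ(A∩A′) ≤ sStarD (X∪Y) A A′` for all up-sets `A, A′`, where `Φ(W)` is the closed-form (T)-slack of `pairCert_slack_eq` (a
nonnegative combination of fibrewise Harris slacks).  This is the inequality (★₁) of the generation-20 memo, the hypothesis the successor has to prove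
(by the lifts (L0),(L1),(L2) along the cell block). [this work] -/
theorem pairCert_N_of_sStarD_ge {X Y : Finset (Pd (n + k))} {XI : Finset (Pd n)} {YJ : Finset (Pd k)}
    (hX : ∀ ξ q, glue ξ q ∈ X ↔ ξ ∈ XI) (hY : ∀ ξ q, glue ξ q ∈ Y ↔ q ∈ YJ)
    (hS : ∀ A A' : Finset (Pd (n + k)), IsUpperSet (A : Set (Pd (n + k))) → IsUpperSet (A' : Set (Pd (n + k))) →
      2 ^ k * (∑ q : Pd k, (1 - ind YJ q) * ∑ ξ : Pd n, ind (fibre (A ∩ A') q) ξ * (2 ^ n * ind XI ξ - (nuCount XI ξ : ℤ)))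
        + (∑ ξ : Pd n, (1 - ind XI ξ) * (2 ^ n - (nuCount XI ξ : ℤ)) * ∑ q : Pd k, ind (sect (A ∩ A') ξ) q * (2 ^ k * ind YJ q - (nuCount YJ q : ℤ)))
        ≤ sStarD (X ∪ Y) A A') :
    ∀ A A' : Finset (Pd (n + k)), IsUpperSet (A : Set (Pd (n + k))) → IsUpperSet (A' : Set (Pd (n + k))) →
      (∑ q ∈ A, ∑ r ∈ A', thetaVal (X ∪ Y) q r) ≤
        ∑ x ∈ A ∩ A', ((2:ℤ) ^ (n + k) * (ind X x + ind Y x) - ind X x * ((nuCount (X ∪ Y) x : ℤ) - nuCount X x)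
          - ind X x * ind Y x * (nuCount X x : ℤ)) := by
  intro A A' hA hA'
  have h1 := sStarD_eq_sum_lamU_sub_sum_thetaVal (X ∪ Y) A A'
  have h2 := pairCert_slack_eq hX hY (A ∩ A')
  have h3 := hS A A' hA hA'
  rw [Finset.sum_sub_distrib] at h2
  linarith

/-- **EVERY-DIMENSION GOODNESS OF A UNION OF TWO INDEPENDENT CYLINDERS FROM (★₁)**: if `sStarD (X∪Y) A A′ ≥ Φ(A∩A′)` for all up-sets
`A, A′ ⊆ [3]^{n+k}` (`Φ` the closed-form slack of `pairCert_slack_eq`), then `(X∪Y) × [3]^m` is a good slot of the pattern functional in every dimension.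
(= `sStarD_cylSet_pairCert_nonneg_of_N` ∘ `pairCert_N_of_sStarD_ge`.)  For principal blocks the hypothesis was verified by exact computation for
`n + k ≤ 4`; it is open in general. [this work] -/
theorem sStarD_cylSet_pairCert_nonneg_of_sStarD_ge {m : ℕ} {X Y : Finset (Pd (n + k))} {XI : Finset (Pd n)} {YJ : Finset (Pd k)}
    (hX : ∀ ξ q, glue ξ q ∈ X ↔ ξ ∈ XI) (hY : ∀ ξ q, glue ξ q ∈ Y ↔ q ∈ YJ)
    (hXI : IsUpperSet (XI : Set (Pd n))) (hYJ : IsUpperSet (YJ : Set (Pd k)))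
    (hS : ∀ A A' : Finset (Pd (n + k)), IsUpperSet (A : Set (Pd (n + k))) → IsUpperSet (A' : Set (Pd (n + k))) →
      2 ^ k * (∑ q : Pd k, (1 - ind YJ q) * ∑ ξ : Pd n, ind (fibre (A ∩ A') q) ξ * (2 ^ n * ind XI ξ - (nuCount XI ξ : ℤ)))
        + (∑ ξ : Pd n, (1 - ind XI ξ) * (2 ^ n - (nuCount XI ξ : ℤ)) * ∑ q : Pd k, ind (sect (A ∩ A') ξ) q * (2 ^ k * ind YJ q - (nuCount YJ q : ℤ)))
        ≤ sStarD (X ∪ Y) A A')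
    {B C : Finset (Pd (m + (n + k)))} (hB : IsUpperSet (B : Set (Pd (m + (n + k))))) (hC : IsUpperSet (C : Set (Pd (m + (n + k))))) :
    0 ≤ sStarD (cylSet (X ∪ Y) : Finset (Pd (m + (n + k)))) B C :=
  sStarD_cylSet_pairCert_nonneg_of_N hX hY hXI hYJ (pairCert_N_of_sStarD_ge hX hY hS) hB hC

end Summit.CriticalPhenomena.PercolationContinuityZ3.Theorems.SahiGridPattern
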